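import Mathlib
import Literature.NumberTheory.LFunctions.Zhang2022.Section15CU1Bound
import HarnessLib

/-!
# Zhang (2022), Lemma 15.3 part 1 (repaired normaliser, cell RULING 15e): the Euler product
# `U(s) = ∏_q 𝔲ᴿ₁ⱼ(q,s)` is an analytic continuation of `𝒰ᴿ₁ⱼ` to `Re s ≥ 9/10`, with the
# `D`-dependent bound `‖U(s)‖ ≤ exp(2Σ_{q∣D}q^{−9/10} + B)` — kernel-checked (pointwise form)

Topic `Literature/NumberTheory/LFunctions/Zhang2022` (Landau–Siegel audit tree; verdict-neutral).
Y. Zhang, *Discrete mean estimates and the Landau–Siegel zero*, arXiv:2211.02515v1 (2022)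
[Zhang2022LandauSiegel] — **an unrefereed manuscript under adjudication; nothing in this file asserts
or denies its Theorems 1–2.** ZHANG-L discharge lane (WP15), file 7 of the chain towards the leaf
`Typed.Section15C.Lemma153RpI` (rows G-L4t3-1 / G-d52-1): "For `σ ≥ 9/10` the function `𝒰₁ⱼ(s)` …
is analytic and bounded" (Lemma 15.3, p. 87, tex L4344–L4348), for the REPAIRED object
`Section15C.calU1R` and in the per-`D` reading of "bounded" (RULING 15e).

What is PROVED here (theorems only; no new definitions, no facts), for fixed `(D, χ, j)` under the
pointwise hypotheses of the previous files (all true for large `D` under (A)):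
`differentiableOn_frakU1FactorR` (each factor is holomorphic on `Re s > 17/20`),
`frakU1FactorR_tprod_analytic_and_bounded` — with `U(s) := ∏'_q 𝔲ᴿ₁ⱼ(q,s)`:
(i) `U` is analytic on a neighbourhood of `{Re s ≥ 9/10}`, (ii) `U = calU1R` on `Re s > 1`,
(iii) `‖U(s)‖ ≤ exp(2Σ_{q∣D} q^{−9/10} + B(M))` on `Re s ≥ 9/10` with an explicit absolute `B(M)`.
The product machinery (`differentiableOn_tprod_of_summable_bound`) is re-proved privately after
`Section15BCalM1Analytic`.

## References

* Y. Zhang, arXiv:2211.02515v1 (2022), §15 Lemma 15.3 p. 87; App. A p. 105.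
  [cite: Zhang2022LandauSiegel, §15 Lemma 15.3 p. 87]
-/

noncomputable section

open Complex Real Filter Topology Finset

namespace Literature.NumberTheory.LFunctions.Zhang2022.Lemma153Rp

open Literature.NumberTheory.LFunctions.Zhang2022
open Literature.NumberTheory.LFunctions.Zhang2022.Typed.Section15A
open Literature.NumberTheory.LFunctions.Zhang2022.Typed.Section15B

/-! ## §1. Products of holomorphic factors close to `1` (after `Section15BCalM1Analytic`) -/

/-- `‖∏_{i∈A} g(i) − 1‖ ≤ exp(Σ_{i∈A} ‖g(i) − 1‖) − 1`. [folklore] -/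
private theorem norm_prod_sub_one_le {ι : Type*} (A : Finset ι) (g : ι → ℂ) :
    ‖∏ i ∈ A, g i - 1‖ ≤ Real.exp (∑ i ∈ A, ‖g i - 1‖) - 1 := by
  have h := A.norm_prod_one_add_sub_one_le (fun i => g i - 1)
  simpa only [add_sub_cancel] using h

/-- Tail control for an unconditional product. [folklore] -/
private theorem norm_hasProd_sub_prod_le {ι : Type*} {F : ι → ℂ} {a : ℂ} (hF : HasProd F a)
    (S : Finset ι) {b : ι → ℝ} (hb0 : ∀ i, 0 ≤ b i) (hb : Summable b)
    (hFb : ∀ i ∉ S, ‖F i - 1‖ ≤ b i) :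
    ‖a - ∏ i ∈ S, F i‖ ≤ ‖∏ i ∈ S, F i‖ * (Real.exp (∑' i, b i) - 1) := by
  classical
  set P := ∏ i ∈ S, F i with hPdef
  set R := ‖P‖ * (Real.exp (∑' i, b i) - 1) with hRdef
  have hA : ∀ A : Finset ι, S ≤ A → ‖∏ i ∈ A, F i - P‖ ≤ R := by
    intro A hSA
    have hsplit : ∏ i ∈ A, F i = P * ∏ i ∈ A \ S, F i := by
      rw [hPdef, ← Finset.prod_sdiff hSA, mul_comm]
    have h1 : ‖∏ i ∈ A \ S, F i - 1‖ ≤ Real.exp (∑' i, b i) - 1 := by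
      refine (norm_prod_sub_one_le _ _).trans ?_
      have hle : ∑ i ∈ A \ S, ‖F i - 1‖ ≤ ∑' i, b i :=
        calc ∑ i ∈ A \ S, ‖F i - 1‖ ≤ ∑ i ∈ A \ S, b i :=
              Finset.sum_le_sum fun i hi => hFb i (Finset.mem_sdiff.mp hi).2
          _ ≤ ∑' i, b i := hb.sum_le_tsum _ (fun i _ => hb0 i)
      linarith [Real.exp_le_exp.mpr hle]
    calc ‖∏ i ∈ A, F i - P‖ = ‖P * (∏ i ∈ A \ S, F i - 1)‖ := by rw [hsplit]; ring_nf
      _ = ‖P‖ * ‖∏ i ∈ A \ S, F i - 1‖ := norm_mul _ _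
      _ ≤ R := mul_le_mul_of_nonneg_left h1 (norm_nonneg _)
  have hT : Tendsto (fun A : Finset ι => ∏ i ∈ A, F i) atTop (𝓝 a) := hF
  have hclosed : IsClosed {z : ℂ | ‖z - P‖ ≤ R} :=
    isClosed_le (continuous_id.sub continuous_const).norm continuous_const
  exact hclosed.mem_of_tendsto hT (Filter.eventually_atTop.mpr ⟨S, fun A hA' => hA A hA'⟩)

/-- A product of holomorphic factors close to `1` is holomorphic (uniform convergence of the partial
products; re-proved after `Section15BCalM1Analytic`). [folklore] -/
private theorem differentiableOn_tprod_of_summable_bound {ι : Type*} {U : Set ℂ} (hU : IsOpen U)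
    {F : ι → ℂ → ℂ} {b : ι → ℝ} (hF : ∀ i, DifferentiableOn ℂ (F i) U) (hb0 : ∀ i, 0 ≤ b i)
    (hb : Summable b) (hFb : ∀ i, ∀ s ∈ U, ‖F i s - 1‖ ≤ b i) :
    (∀ s ∈ U, Multipliable fun i => F i s) ∧ DifferentiableOn ℂ (fun s => ∏' i, F i s) U := by
  classical
  have hmul : ∀ s ∈ U, Multipliable fun i => F i s := by
    intro s hs
    have hsum : Summable fun i => ‖F i s - 1‖ :=
      Summable.of_nonneg_of_le (fun _ => norm_nonneg _) (fun i => hFb i s hs) hb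
    have h := multipliable_one_add_of_summable hsum
    simpa only [add_sub_cancel] using h
  refine ⟨hmul, ?_⟩
  set B : ℝ := ∑' i, b i with hBdef
  set T : Finset ι → ℝ := fun A => ∑' i, ((↑A : Set ι)ᶜ).indicator b i with hTdef
  have hest : ∀ (A : Finset ι), ∀ s ∈ U,
      ‖(∏' i, F i s) - ∏ i ∈ A, F i s‖ ≤ Real.exp B * (Real.exp (T A) - 1) := by
    intro A s hs
    have hind0 : ∀ i, 0 ≤ ((↑A : Set ι)ᶜ).indicator b i := fun i =>
      Set.indicator_nonneg (fun j _ => hb0 j) i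
    have hind : ∀ i ∉ A, ‖F i s - 1‖ ≤ ((↑A : Set ι)ᶜ).indicator b i := by
      intro i hi
      rw [Set.indicator_of_mem (by simpa using hi)]
      exact hFb i s hs
    have h1 := norm_hasProd_sub_prod_le (hmul s hs).hasProd A hind0 (hb.indicator _) hind
    have hP : ‖∏ i ∈ A, F i s‖ ≤ Real.exp B := by
      have h2 := norm_prod_sub_one_le A (fun i => F i s)
      have h3 : ∑ i ∈ A, ‖F i s - 1‖ ≤ B :=
        calc ∑ i ∈ A, ‖F i s - 1‖ ≤ ∑ i ∈ A, b i := Finset.sum_le_sum fun i _ => hFb i s hs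
          _ ≤ B := hb.sum_le_tsum _ (fun i _ => hb0 i)
      have h4 : ‖∏ i ∈ A, F i s‖ ≤ ‖∏ i ∈ A, F i s - 1‖ + ‖(1 : ℂ)‖ := by
        have := norm_add_le (∏ i ∈ A, F i s - 1) 1
        rwa [sub_add_cancel] at this
      rw [norm_one] at h4
      linarith [Real.exp_le_exp.mpr h3]
    have hT0 : 0 ≤ Real.exp (T A) - 1 := by
      have : 0 ≤ T A := tsum_nonneg hind0
      linarith [Real.add_one_le_exp (T A)]
    calc ‖(∏' i, F i s) - ∏ i ∈ A, F i s‖ ≤ ‖∏ i ∈ A, F i s‖ * (Real.exp (T A) - 1) := h1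
      _ ≤ Real.exp B * (Real.exp (T A) - 1) := mul_le_mul_of_nonneg_right hP hT0
  have hTlim : Tendsto T atTop (𝓝 0) := by
    have h := tendsto_tsum_compl_atTop_zero b
    refine h.congr fun A => ?_
    rw [hTdef]
    exact (tsum_subtype ((↑A : Set ι)ᶜ) b)
  have hglim : Tendsto (fun A => Real.exp B * (Real.exp (T A) - 1)) atTop (𝓝 0) := by
    have h1 : Tendsto (fun A => Real.exp (T A)) atTop (𝓝 (Real.exp 0)) :=
      (Real.continuous_exp.tendsto 0).comp hTlim
    rw [Real.exp_zero] at h1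
    have h2 : Tendsto (fun A => Real.exp (T A) - 1) atTop (𝓝 (1 - 1)) := h1.sub_const 1
    rw [sub_self] at h2
    simpa using h2.const_mul (Real.exp B)
  have hunif : TendstoUniformlyOn (fun A s => ∏ i ∈ A, F i s) (fun s => ∏' i, F i s) atTop U := by
    rw [Metric.tendstoUniformlyOn_iff]
    intro ε hε
    filter_upwards [hglim.eventually (gt_mem_nhds hε)] with A hA s hs
    rw [dist_eq_norm]
    exact (hest A s hs).trans_lt hA
  refine hunif.tendstoLocallyUniformlyOn.differentiableOn
    (Filter.Eventually.of_forall fun A => ?_) hU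
  exact DifferentiableOn.fun_finsetProd fun i _ => hF i

/-- `‖∏' f‖ ≤ exp(Σ' c)` if `‖f(i)‖ ≤ exp(c(i))` with `c ≥ 0` summable and `f` multipliable. [folklore] -/
private theorem norm_tprod_le_exp_of_norm_le_exp {ι : Type*} {f : ι → ℂ} {c : ι → ℝ}
    (hf : Multipliable f) (hc0 : ∀ i, 0 ≤ c i) (hc : Summable c) (hfc : ∀ i, ‖f i‖ ≤ Real.exp (c i)) :
    ‖∏' i, f i‖ ≤ Real.exp (∑' i, c i) := by
  classical
  have hT : Tendsto (fun A : Finset ι => ∏ i ∈ A, f i) atTop (𝓝 (∏' i, f i)) := hf.hasProd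
  have hbound : ∀ A : Finset ι, ‖∏ i ∈ A, f i‖ ≤ Real.exp (∑' i, c i) := by
    intro A
    calc ‖∏ i ∈ A, f i‖ = ∏ i ∈ A, ‖f i‖ := norm_prod _ _
      _ ≤ ∏ i ∈ A, Real.exp (c i) := prod_le_prod (fun i _ => norm_nonneg _) fun i _ => hfc i
      _ = Real.exp (∑ i ∈ A, c i) := (Real.exp_sum _ _).symm
      _ ≤ Real.exp (∑' i, c i) := Real.exp_le_exp.mpr (hc.sum_le_tsum A fun i _ => hc0 i)
  have hclosed : IsClosed {z : ℂ | ‖z‖ ≤ Real.exp (∑' i, c i)} :=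
    isClosed_le continuous_norm continuous_const
  exact hclosed.mem_of_tendsto hT (Filter.Eventually.of_forall hbound)

variable (c' : ℝ) {D : ℕ} (χ : DirichletCharacter ℂ D)

/-! ## §2. Each factor `𝔲ᴿ₁ⱼ(q,·)` is holomorphic on `Re s > 17/20` -/

/-- `s ↦ q^{−s}` is differentiable. [folklore] -/
private theorem differentiable_cpow_neg {q : ℕ} (hq : q.Prime) :
    Differentiable ℂ (fun s : ℂ => (q : ℂ) ^ (-s)) := by
  have hqC : (q : ℂ) ≠ 0 := by exact_mod_cast hq.ne_zero
  intro s
  exact (differentiableAt_id.neg).const_cpow (Or.inl hqC)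

/-- **Each repaired Euler factor is holomorphic on `Re s > 17/20`** (indeed on `Re s > 0`): for
`χ(q) = 0` it is `(1 − q^{−s})²`, and for `χ(q) = ±1` it is the polynomial in `q^{−s}` of
`frakU1FactorR_eq_poly`. [cite: Zhang2022LandauSiegel, §15 Lemma 15.3 p. 87] -/
theorem differentiableOn_frakU1FactorR [NeZero D] (hquad : χ.IsQuadratic) {q : ℕ} (hq : q.Prime)
    (j : ℕ) (hmul : Multipliable fun p : Nat.Primes =>
      calM1Factor c' χ (p : ℕ) 1 1 (1 - Skeleton.betaJ c' D j))
    (hne : calM1 c' χ 1 1 (1 - Skeleton.betaJ c' D j) ≠ 0) (h1 : varpi1 c' χ j 1 = 1) :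
    DifferentiableOn ℂ (fun s => Typed.AppendixA2.frakU1FactorR c' χ j q s) {s : ℂ | 17 / 20 < s.re} := by
  have hx := differentiable_cpow_neg hq
  rcases hquad (q : ZMod D) with h0 | hpm
  · -- `χ(q) = 0`
    have heq : ∀ s : ℂ, Typed.AppendixA2.frakU1FactorR c' χ j q s = (1 - (q : ℂ) ^ (-s)) ^ 2 :=
      fun s => frakU1FactorR_eq_of_chi_eq_zero c' χ h0 j h1 s
    have hd : Differentiable ℂ (fun s : ℂ => (1 - (q : ℂ) ^ (-s)) ^ 2) :=
      ((differentiable_const _).sub hx).pow 2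
    exact (hd.differentiableOn).congr fun s _ => heq s
  · have hv : χ (q : ZMod D) ^ 2 = 1 := by
      rcases hpm with h | h <;> simp [h]
    -- the polynomial closed form on `Re s > 0`
    refine DifferentiableOn.congr (f := fun s : ℂ =>
      (1 - (q : ℂ) ^ (-s)) ^ 2 *
          (1 - χ (q : ZMod D) * (q : ℂ) ^ Skeleton.betaJ c' D j * (q : ℂ) ^ (-s)) ^ 2 +
        calM1Factor c' χ q 1 q (1 - Skeleton.betaJ c' D j) /
            calM1Factor c' χ q 1 1 (1 - Skeleton.betaJ c' D j) *
          ((1 - χ (q : ZMod D) * (q : ℂ) ^ Skeleton.betaJ c' D j * (q : ℂ) ^ (-s)) ^ 2 *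
            (2 * (q : ℂ) ^ (-s) - ((q : ℂ) ^ (-s)) ^ 2)) +
        lam1 c' χ q 1 * calM1Factor c' χ q q 1 (1 - Skeleton.betaJ c' D j) /
            calM1Factor c' χ q 1 1 (1 - Skeleton.betaJ c' D j) *
          ((1 - (q : ℂ) ^ (-s)) ^ 2 *
            (2 * (χ (q : ZMod D) * (q : ℂ) ^ Skeleton.betaJ c' D j * (q : ℂ) ^ (-s)) -
              (χ (q : ZMod D) * (q : ℂ) ^ Skeleton.betaJ c' D j * (q : ℂ) ^ (-s)) ^ 2)) +
        lam1 c' χ q 1 * calM1Factor c' χ q q q (1 - Skeleton.betaJ c' D j) /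
            calM1Factor c' χ q 1 1 (1 - Skeleton.betaJ c' D j) *
          ((χ (q : ZMod D) * (q : ℂ) ^ Skeleton.betaJ c' D j * (q : ℂ) ^ (-s)) * (q : ℂ) ^ (-s) *
            (3 - 2 * (q : ℂ) ^ (-s) - 2 * (χ (q : ZMod D) * (q : ℂ) ^ Skeleton.betaJ c' D j * (q : ℂ) ^ (-s)) +
              (χ (q : ZMod D) * (q : ℂ) ^ Skeleton.betaJ c' D j * (q : ℂ) ^ (-s)) * (q : ℂ) ^ (-s)))) ?_ ?_
    · apply Differentiable.differentiableOn
      have hw : Differentiable ℂ (fun s : ℂ =>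
          χ (q : ZMod D) * (q : ℂ) ^ Skeleton.betaJ c' D j * (q : ℂ) ^ (-s)) :=
        (differentiable_const _).mul hx
      fun_prop
    · intro s hs
      have hs0 : 0 < s.re := by have : 17 / 20 < s.re := hs; linarith
      exact frakU1FactorR_eq_poly c' χ hq hv j hmul hne hs0

/-! ## §3. The continuation: analytic on `Re s > 17/20`, equal to `calU1R` on `Re s > 1`, bounded on
`Re s ≥ 9/10` by `exp(2Σ_{q∣D}q^{−9/10} + B)` -/

/-- `χ(q) = 0` at a prime `q` forces `q ∣ D` (a Dirichlet character vanishes only off the units).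
[cite: Zhang2022LandauSiegel, §15 Lemma 15.3 p. 87] -/
theorem dvd_of_chi_eq_zero [NeZero D] {q : ℕ} (hq : q.Prime) (h0 : χ (q : ZMod D) = 0) : q ∣ D := by
  by_contra hnd
  have hcop : Nat.Coprime q D := (Nat.Prime.coprime_iff_not_dvd hq).mpr hnd
  have hu : IsUnit (q : ZMod D) := (ZMod.isUnit_iff_coprime q D).mpr hcop
  have := (hu.map χ).ne_zero
  exact this h0

/-- `‖q^{−s}‖ ≤ q^{−σ₀}` for `Re s ≥ σ₀`. [folklore] -/
private theorem norm_cpow_neg_le {q : ℕ} (hq : q.Prime) {s : ℂ} {σ₀ : ℝ} (hs : σ₀ ≤ s.re) :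
    ‖(q : ℂ) ^ (-s)‖ ≤ (q : ℝ) ^ (-σ₀) := by
  rw [Complex.norm_natCast_cpow_of_pos hq.pos, Complex.neg_re]
  exact Real.rpow_le_rpow_of_exponent_le (by exact_mod_cast hq.one_lt.le) (by linarith)

/-- **Lemma 15.3 part 1 for the repaired object, pointwise form.** For fixed `(D, χ, j)` with `χ`
quadratic, assume: the Euler product of `𝓜₁(1,1;1−βⱼ)` converges to a non-zero value, `ϖ₁ⱼ` is
multiplicative, `|𝓜₁(qᵃ,qᵇ)/𝓜₁(1,1)| ≤ B` and `‖F_q(1,1)‖⁻¹ ≤ 2K` for all primes `q` (all at `1 − βⱼ`).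
Then `U(s) := ∏'_q 𝔲ᴿ₁ⱼ(q,s)` is analytic on a neighbourhood of `Re s ≥ 9/10`, equals `calU1R(s)` for
`Re s > 1`, and `‖U(s)‖ ≤ exp(2Σ_{q∣D} q^{−9/10} + Σ_q b_q)` on `Re s ≥ 9/10` with
`b_q = q^{−9/5} + (M/q)(24q^{−9/10} + 8q^{−9/5})`, `M = 2K(90Z₂ + 72 + 45W²)`.
[cite: Zhang2022LandauSiegel, §15 Lemma 15.3 p. 87] -/
theorem tprod_frakU1FactorR_analytic_eq_bound [NeZero D] (hquad : χ.IsQuadratic) (j : ℕ)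
    (hmul : Multipliable fun p : Nat.Primes =>
      calM1Factor c' χ (p : ℕ) 1 1 (1 - Skeleton.betaJ c' D j))
    (hne : calM1 c' χ 1 1 (1 - Skeleton.betaJ c' D j) ≠ 0)
    (hmult : varpi1 c' χ j 1 = 1 ∧
      ∀ m n : ℕ, Nat.Coprime m n → varpi1 c' χ j (m * n) = varpi1 c' χ j m * varpi1 c' χ j n)
    {B : ℝ} (hB : ∀ q : ℕ, q.Prime → ∀ a b : ℕ, ‖calM1 c' χ (q ^ a) (q ^ b) (1 - Skeleton.betaJ c' D j) /
      calM1 c' χ 1 1 (1 - Skeleton.betaJ c' D j)‖ ≤ B)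
    {K : ℝ} (hK : ∀ q : ℕ, q.Prime →
      ‖calM1Factor c' χ q 1 1 (1 - Skeleton.betaJ c' D j)‖⁻¹ ≤ 2 * K) :
    AnalyticOnNhd ℂ (fun s => ∏' q : Nat.Primes, Typed.AppendixA2.frakU1FactorR c' χ j (q : ℕ) s)
        {s : ℂ | 9 / 10 ≤ s.re} ∧
      (∀ s : ℂ, 1 < s.re → (∏' q : Nat.Primes, Typed.AppendixA2.frakU1FactorR c' χ j (q : ℕ) s) =
        Typed.Section15C.calU1R c' Typed.Section15C.inputs15AB χ j s) ∧
      (∀ s : ℂ, 9 / 10 ≤ s.re →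
        ‖∏' q : Nat.Primes, Typed.AppendixA2.frakU1FactorR c' χ j (q : ℕ) s‖ ≤
          Real.exp (2 * ∑ q ∈ D.primeFactors, (q : ℝ) ^ (-(9 / 10 : ℝ)) +
            ∑' q : Nat.Primes, (((q : ℕ) : ℝ) ^ (-(9 / 5 : ℝ)) +
              2 * K * (90 * (∑' m : ℕ, ((m : ℝ) + 1) ^ 2 * (1 / 2 : ℝ) ^ m) + 72 +
                  45 * (∑' m : ℕ, ((m : ℝ) + 2) ^ 2 * (1 / 2 : ℝ) ^ m) ^ 2) / (q : ℕ) *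
                (24 * ((q : ℕ) : ℝ) ^ (-(9 / 10 : ℝ)) + 8 * ((q : ℕ) : ℝ) ^ (-(9 / 5 : ℝ)))))) := by
  classical
  set M : ℝ := 2 * K * (90 * (∑' m : ℕ, ((m : ℝ) + 1) ^ 2 * (1 / 2 : ℝ) ^ m) + 72 +
    45 * (∑' m : ℕ, ((m : ℝ) + 2) ^ 2 * (1 / 2 : ℝ) ^ m) ^ 2) with hM
  have hK0 : 0 ≤ 2 * K := le_trans (inv_nonneg.mpr (norm_nonneg _)) (hK 2 Nat.prime_two)
  have hM0 : 0 ≤ M := by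
    have h1 : 0 ≤ ∑' m : ℕ, ((m : ℝ) + 1) ^ 2 * (1 / 2 : ℝ) ^ m := tsum_nonneg fun m => by positivity
    have h2 : 0 ≤ ∑' m : ℕ, ((m : ℝ) + 2) ^ 2 * (1 / 2 : ℝ) ^ m := tsum_nonneg fun m => by positivity
    rw [hM]; positivity
  have hD0 : (0 : ℝ) < D := by exact_mod_cast Nat.pos_of_ne_zero (NeZero.ne D)
  set F : Nat.Primes → ℂ → ℂ := fun q s => Typed.AppendixA2.frakU1FactorR c' χ j (q : ℕ) s with hF
  -- summability of prime power sums
  have hsum_rpow : ∀ r : ℝ, r < -1 → Summable fun q : Nat.Primes => ((q : ℕ) : ℝ) ^ r := fun r hr =>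
    (Real.summable_nat_rpow.mpr hr).comp_injective Subtype.val_injective
  -- the factor bound at `σ ≥ σ₀`
  have hfac : ∀ (q : Nat.Primes) (s : ℂ) (σ₀ : ℝ), 0 < σ₀ → σ₀ ≤ s.re → χ ((q : ℕ) : ZMod D) ^ 2 = 1 →
      ‖F q s - 1‖ ≤ ((q : ℕ) : ℝ) ^ (-(2 * σ₀)) +
        M / (q : ℕ) * (24 * ((q : ℕ) : ℝ) ^ (-σ₀) + 8 * ((q : ℕ) : ℝ) ^ (-(2 * σ₀))) := by
    intro q s σ₀ hσ₀ hs hv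
    have hq := q.prop
    have hq0 : (0 : ℝ) < (q : ℕ) := by exact_mod_cast hq.pos
    have hx := norm_cpow_neg_le hq hs
    have hx0 : 0 ≤ ‖((q : ℕ) : ℂ) ^ (-s)‖ := norm_nonneg _
    have hx2 : ‖((q : ℕ) : ℂ) ^ (-s)‖ ^ 2 ≤ ((q : ℕ) : ℝ) ^ (-(2 * σ₀)) := by
      calc ‖((q : ℕ) : ℂ) ^ (-s)‖ ^ 2 ≤ (((q : ℕ) : ℝ) ^ (-σ₀)) ^ 2 := pow_le_pow_left₀ hx0 hx 2
        _ = ((q : ℕ) : ℝ) ^ (-(2 * σ₀)) := by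
            rw [← Real.rpow_natCast, ← Real.rpow_mul hq0.le]; congr 1; push_cast; ring
    have h := norm_frakU1FactorR_sub_one_le c' χ hq hv j hmul hne (hK q hq) (show 0 < s.re by linarith)
    have hMq : 0 ≤ M / (q : ℕ) := by positivity
    calc ‖F q s - 1‖ ≤ ‖((q : ℕ) : ℂ) ^ (-s)‖ ^ 2 +
          M / (q : ℕ) * (24 * ‖((q : ℕ) : ℂ) ^ (-s)‖ + 8 * ‖((q : ℕ) : ℂ) ^ (-s)‖ ^ 2) := by
          simpa [hF, hM] using h
      _ ≤ ((q : ℕ) : ℝ) ^ (-(2 * σ₀)) +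
          M / (q : ℕ) * (24 * ((q : ℕ) : ℝ) ^ (-σ₀) + 8 * ((q : ℕ) : ℝ) ^ (-(2 * σ₀))) := by
          gcongr
  -- the factors at `χ(q) = 0`
  have hfac0 : ∀ (q : Nat.Primes) (s : ℂ), χ ((q : ℕ) : ZMod D) = 0 →
      F q s = (1 - ((q : ℕ) : ℂ) ^ (-s)) ^ 2 := fun q s h0 =>
    frakU1FactorR_eq_of_chi_eq_zero c' χ h0 j hmult.1 s
  have hcases : ∀ q : Nat.Primes, χ ((q : ℕ) : ZMod D) = 0 ∨ χ ((q : ℕ) : ZMod D) ^ 2 = 1 := by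
    intro q
    rcases hquad ((q : ℕ) : ZMod D) with h | h | h
    · exact Or.inl h
    · exact Or.inr (by simp [h])
    · exact Or.inr (by simp [h])
  ------------------------------------------------------------------
  -- (i) analyticity on `U₀ = {Re s > 17/20}`
  ------------------------------------------------------------------
  set U₀ : Set ℂ := {s : ℂ | 17 / 20 < s.re} with hU₀
  have hU₀open : IsOpen U₀ := isOpen_lt continuous_const Complex.continuous_re
  set b : Nat.Primes → ℝ := fun q => 3 * (D : ℝ) ^ 2 * ((q : ℕ) : ℝ) ^ (-(2 : ℝ)) +
    (((q : ℕ) : ℝ) ^ (-(2 * (17 / 20 : ℝ))) +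
      M / (q : ℕ) * (24 * ((q : ℕ) : ℝ) ^ (-(17 / 20 : ℝ)) + 8 * ((q : ℕ) : ℝ) ^ (-(2 * (17 / 20 : ℝ)))))
    with hb
  have hb0 : ∀ q, 0 ≤ b q := fun q => by
    have : (0 : ℝ) < (q : ℕ) := by exact_mod_cast q.prop.pos
    simp only [hb]; positivity
  have hbsum : Summable b := by
    have h1 : Summable fun q : Nat.Primes => 3 * (D : ℝ) ^ 2 * ((q : ℕ) : ℝ) ^ (-(2 : ℝ)) :=
      (hsum_rpow _ (by norm_num)).mul_left _
    have h2 : Summable fun q : Nat.Primes => ((q : ℕ) : ℝ) ^ (-(2 * (17 / 20 : ℝ))) :=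
      hsum_rpow _ (by norm_num)
    have h3 : Summable fun q : Nat.Primes =>
        M / (q : ℕ) * (24 * ((q : ℕ) : ℝ) ^ (-(17 / 20 : ℝ)) + 8 * ((q : ℕ) : ℝ) ^ (-(2 * (17 / 20 : ℝ)))) := by
      have h31 : Summable fun q : Nat.Primes => ((q : ℕ) : ℝ) ^ (-(1 + 17 / 20 : ℝ)) :=
        hsum_rpow _ (by norm_num)
      have h32 : Summable fun q : Nat.Primes => ((q : ℕ) : ℝ) ^ (-(1 + 2 * (17 / 20) : ℝ)) :=
        hsum_rpow _ (by norm_num)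
      refine (((h31.mul_left (24 * M)).add (h32.mul_left (8 * M)))).congr fun q => ?_
      have hq0 : (0 : ℝ) < (q : ℕ) := by exact_mod_cast q.prop.pos
      have e1 : ((q : ℕ) : ℝ) ^ (-(1 + 17 / 20 : ℝ)) = ((q : ℕ) : ℝ)⁻¹ * ((q : ℕ) : ℝ) ^ (-(17 / 20 : ℝ)) := by
        rw [show (-(1 + 17 / 20 : ℝ)) = -1 + -(17 / 20 : ℝ) by norm_num, Real.rpow_add hq0,
          Real.rpow_neg_one]
      have e2 : ((q : ℕ) : ℝ) ^ (-(1 + 2 * (17 / 20) : ℝ)) =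
          ((q : ℕ) : ℝ)⁻¹ * ((q : ℕ) : ℝ) ^ (-(2 * (17 / 20 : ℝ))) := by
        rw [show (-(1 + 2 * (17 / 20) : ℝ)) = -1 + -(2 * (17 / 20 : ℝ)) by norm_num, Real.rpow_add hq0,
          Real.rpow_neg_one]
      rw [e1, e2, div_eq_mul_inv]; ring
    exact (h1.add (h2.add h3))
  have hFb : ∀ q, ∀ s ∈ U₀, ‖F q s - 1‖ ≤ b q := by
    intro q s hs
    have hs' : 17 / 20 < s.re := hs
    have hq := q.prop
    have hq0 : (0 : ℝ) < (q : ℕ) := by exact_mod_cast hq.pos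
    rcases hcases q with h0 | hv
    · -- `χ(q) = 0`: `‖(1−x)² − 1‖ ≤ 3 ≤ 3D²/q²`
      have hqD : (q : ℕ) ∣ D := dvd_of_chi_eq_zero χ hq h0
      have hqle : ((q : ℕ) : ℝ) ≤ D := by exact_mod_cast Nat.le_of_dvd (Nat.pos_of_ne_zero (NeZero.ne D)) hqD
      have hx1 : ‖((q : ℕ) : ℂ) ^ (-s)‖ ≤ 1 := by
        rw [Complex.norm_natCast_cpow_of_pos hq.pos, Complex.neg_re]
        exact Real.rpow_le_one_of_one_le_of_nonpos (by exact_mod_cast hq.one_lt.le) (by linarith)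
      rw [hfac0 q s h0]
      have h3 : ‖(1 - ((q : ℕ) : ℂ) ^ (-s)) ^ 2 - 1‖ ≤ 3 := by
        have e : (1 - ((q : ℕ) : ℂ) ^ (-s)) ^ 2 - 1 =
            -(2 * ((q : ℕ) : ℂ) ^ (-s)) + (((q : ℕ) : ℂ) ^ (-s)) ^ 2 := by ring
        rw [e]
        calc _ ≤ ‖-(2 * ((q : ℕ) : ℂ) ^ (-s))‖ + ‖(((q : ℕ) : ℂ) ^ (-s)) ^ 2‖ := norm_add_le _ _
          _ = 2 * ‖((q : ℕ) : ℂ) ^ (-s)‖ + ‖((q : ℕ) : ℂ) ^ (-s)‖ ^ 2 := by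
              rw [norm_neg, norm_mul, norm_pow]; simp
          _ ≤ 2 * 1 + 1 ^ 2 := by gcongr
          _ = 3 := by norm_num
      have hrest : 0 ≤ ((q : ℕ) : ℝ) ^ (-(2 * (17 / 20 : ℝ))) +
          M / (q : ℕ) * (24 * ((q : ℕ) : ℝ) ^ (-(17 / 20 : ℝ)) + 8 * ((q : ℕ) : ℝ) ^ (-(2 * (17 / 20 : ℝ)))) := by
        positivity
      have hD2 : 3 ≤ 3 * (D : ℝ) ^ 2 * ((q : ℕ) : ℝ) ^ (-(2 : ℝ)) := by
        rw [Real.rpow_neg hq0.le, show (2 : ℝ) = ((2 : ℕ) : ℝ) by norm_num, Real.rpow_natCast]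
        rw [mul_assoc, ← div_eq_mul_inv]
        have : 1 ≤ (D : ℝ) ^ 2 / ((q : ℕ) : ℝ) ^ 2 := by
          rw [le_div_iff₀ (by positivity), one_mul]
          exact pow_le_pow_left₀ hq0.le hqle 2
        linarith
      simp only [hb]
      linarith
    · have h := hfac q s (17 / 20) (by norm_num) hs'.le hv
      simp only [hb]
      have : 0 ≤ 3 * (D : ℝ) ^ 2 * ((q : ℕ) : ℝ) ^ (-(2 : ℝ)) := by positivity
      linarith
  have hFdiff : ∀ q, DifferentiableOn ℂ (F q) U₀ := fun q =>
    differentiableOn_frakU1FactorR c' χ hquad q.prop j hmul hne hmult.1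
  obtain ⟨hmulU, hdiffU⟩ := differentiableOn_tprod_of_summable_bound hU₀open hFdiff hb0 hbsum hFb
  have hanalytic : AnalyticOnNhd ℂ (fun s => ∏' q : Nat.Primes, F q s) {s : ℂ | 9 / 10 ≤ s.re} :=
    (hdiffU.analyticOnNhd hU₀open).mono fun s hs => by
      have : 9 / 10 ≤ s.re := hs
      show 17 / 20 < s.re
      linarith
  refine ⟨hanalytic, fun s hs => calU1R_eq_tprod c' χ j hB hmult hs |>.symm, fun s hs => ?_⟩
  ------------------------------------------------------------------
  -- (iii) the bound on `Re s ≥ 9/10`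
  ------------------------------------------------------------------
  have hs' : 17 / 20 < s.re := by linarith
  have hmuls : Multipliable fun q => F q s := hmulU s hs'
  -- the majorant `c = c¹ + c²`
  set c₁ : Nat.Primes → ℝ := fun q => if (q : ℕ) ∣ D then 2 * ((q : ℕ) : ℝ) ^ (-(9 / 10 : ℝ)) else 0
    with hc₁
  set c₂ : Nat.Primes → ℝ := fun q => ((q : ℕ) : ℝ) ^ (-(9 / 5 : ℝ)) +
    M / (q : ℕ) * (24 * ((q : ℕ) : ℝ) ^ (-(9 / 10 : ℝ)) + 8 * ((q : ℕ) : ℝ) ^ (-(9 / 5 : ℝ))) with hc₂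
  have hc₁0 : ∀ q, 0 ≤ c₁ q := fun q => by simp only [hc₁]; split_ifs <;> positivity
  have hc₂0 : ∀ q, 0 ≤ c₂ q := fun q => by
    have : (0 : ℝ) < (q : ℕ) := by exact_mod_cast q.prop.pos
    simp only [hc₂]; positivity
  -- `c₁` is supported on the prime factors of `D`
  set emb : {q // q ∈ D.primeFactors} → Nat.Primes :=
    fun q => ⟨q.1, Nat.prime_of_mem_primeFactors q.2⟩ with hemb
  have hemb_inj : Function.Injective emb := by
    intro a b h
    exact Subtype.ext (by simpa [hemb] using congrArg Subtype.val h)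
  set S : Finset Nat.Primes := D.primeFactors.attach.image emb with hS
  have hmemS : ∀ p : Nat.Primes, p ∈ S ↔ (p : ℕ) ∣ D := by
    intro p
    constructor
    · intro hp
      obtain ⟨q, -, hq⟩ := Finset.mem_image.mp hp
      rw [← hq]
      exact Nat.dvd_of_mem_primeFactors q.2
    · intro hp
      have hmem : (p : ℕ) ∈ D.primeFactors := Nat.mem_primeFactors.mpr ⟨p.prop, hp, NeZero.ne D⟩
      exact Finset.mem_image.mpr ⟨⟨p, hmem⟩, Finset.mem_attach _ _, Subtype.ext rfl⟩
  have hc₁S : ∀ q ∉ S, c₁ q = 0 := by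
    intro q hq
    simp only [hc₁, if_neg (fun h => hq ((hmemS q).mpr h))]
  have hc₁sum : Summable c₁ := summable_of_ne_finset_zero hc₁S
  have hc₁tsum : ∑' q, c₁ q = 2 * ∑ q ∈ D.primeFactors, (q : ℝ) ^ (-(9 / 10 : ℝ)) := by
    rw [tsum_eq_sum hc₁S, Finset.mul_sum, ← Finset.sum_attach D.primeFactors, hS,
      Finset.sum_image fun a _ b _ h => hemb_inj h]
    refine Finset.sum_congr rfl fun q _ => ?_
    simp only [hc₁, hemb, if_pos (Nat.dvd_of_mem_primeFactors q.2)]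
  have hc₂sum : Summable c₂ := by
    have h2 : Summable fun q : Nat.Primes => ((q : ℕ) : ℝ) ^ (-(9 / 5 : ℝ)) := hsum_rpow _ (by norm_num)
    have h31 : Summable fun q : Nat.Primes => ((q : ℕ) : ℝ) ^ (-(1 + 9 / 10 : ℝ)) :=
      hsum_rpow _ (by norm_num)
    have h32 : Summable fun q : Nat.Primes => ((q : ℕ) : ℝ) ^ (-(1 + 9 / 5 : ℝ)) :=
      hsum_rpow _ (by norm_num)
    refine (h2.add ((h31.mul_left (24 * M)).add (h32.mul_left (8 * M)))).congr fun q => ?_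
    have hq0 : (0 : ℝ) < (q : ℕ) := by exact_mod_cast q.prop.pos
    have e1 : ((q : ℕ) : ℝ) ^ (-(1 + 9 / 10 : ℝ)) = ((q : ℕ) : ℝ)⁻¹ * ((q : ℕ) : ℝ) ^ (-(9 / 10 : ℝ)) := by
      rw [show (-(1 + 9 / 10 : ℝ)) = -1 + -(9 / 10 : ℝ) by norm_num, Real.rpow_add hq0, Real.rpow_neg_one]
    have e2 : ((q : ℕ) : ℝ) ^ (-(1 + 9 / 5 : ℝ)) = ((q : ℕ) : ℝ)⁻¹ * ((q : ℕ) : ℝ) ^ (-(9 / 5 : ℝ)) := by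
      rw [show (-(1 + 9 / 5 : ℝ)) = -1 + -(9 / 5 : ℝ) by norm_num, Real.rpow_add hq0, Real.rpow_neg_one]
    simp only [hc₂]
    rw [e1, e2, div_eq_mul_inv]; ring
  have hcsum : Summable (fun q => c₁ q + c₂ q) := hc₁sum.add hc₂sum
  have hfc : ∀ q, ‖F q s‖ ≤ Real.exp (c₁ q + c₂ q) := by
    intro q
    have hq := q.prop
    have hq0 : (0 : ℝ) < (q : ℕ) := by exact_mod_cast hq.pos
    rcases hcases q with h0 | hv
    · -- `‖(1 − x)²‖ ≤ (1 + q^{−9/10})² ≤ exp(2q^{−9/10})`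
      have hqD : (q : ℕ) ∣ D := dvd_of_chi_eq_zero χ hq h0
      rw [hfac0 q s h0, norm_pow]
      have hx := norm_cpow_neg_le hq hs
      have h1 : ‖1 - ((q : ℕ) : ℂ) ^ (-s)‖ ≤ 1 + ((q : ℕ) : ℝ) ^ (-(9 / 10 : ℝ)) := by
        calc ‖1 - ((q : ℕ) : ℂ) ^ (-s)‖ ≤ ‖(1 : ℂ)‖ + ‖((q : ℕ) : ℂ) ^ (-s)‖ := norm_sub_le _ _
          _ ≤ 1 + ((q : ℕ) : ℝ) ^ (-(9 / 10 : ℝ)) := by rw [norm_one]; gcongr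
      have hy0 : 0 ≤ ((q : ℕ) : ℝ) ^ (-(9 / 10 : ℝ)) := by positivity
      have h2 : 1 + ((q : ℕ) : ℝ) ^ (-(9 / 10 : ℝ)) ≤ Real.exp (((q : ℕ) : ℝ) ^ (-(9 / 10 : ℝ))) :=
        by linarith [Real.add_one_le_exp (((q : ℕ) : ℝ) ^ (-(9 / 10 : ℝ)))]
      have hc1q : c₁ q = 2 * ((q : ℕ) : ℝ) ^ (-(9 / 10 : ℝ)) := by simp only [hc₁, if_pos hqD]
      calc ‖1 - ((q : ℕ) : ℂ) ^ (-s)‖ ^ 2 ≤ (Real.exp (((q : ℕ) : ℝ) ^ (-(9 / 10 : ℝ)))) ^ 2 :=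
            pow_le_pow_left₀ (norm_nonneg _) (h1.trans h2) 2
        _ = Real.exp (c₁ q) := by rw [← Real.exp_nat_mul, hc1q]; norm_num
        _ ≤ Real.exp (c₁ q + c₂ q) := Real.exp_le_exp.mpr (by linarith [hc₂0 q])
    · have h := hfac q s (9 / 10) (by norm_num) hs hv
      have hb' : ‖F q s - 1‖ ≤ c₂ q := by
        simp only [hc₂]
        convert h using 2 <;> norm_num
      calc ‖F q s‖ = ‖(F q s - 1) + 1‖ := by rw [sub_add_cancel]
        _ ≤ ‖F q s - 1‖ + ‖(1 : ℂ)‖ := norm_add_le _ _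
        _ ≤ c₂ q + 1 := by rw [norm_one]; gcongr
        _ ≤ Real.exp (c₂ q) := Real.add_one_le_exp _
        _ ≤ Real.exp (c₁ q + c₂ q) := Real.exp_le_exp.mpr (by linarith [hc₁0 q])
  have hbound := norm_tprod_le_exp_of_norm_le_exp hmuls (fun q => add_nonneg (hc₁0 q) (hc₂0 q)) hcsum hfc
  rw [hc₁sum.tsum_add hc₂sum, hc₁tsum] at hbound
  exact hbound

end Literature.NumberTheory.LFunctions.Zhang2022.Lemma153Rp

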